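import Mathlib
import Summits.MatrixMultiplication.MatrixMultiplication.Theorems.SoloInformedCwTwoHallSix

/-!
# Door D7: the tight case of mixed closure, for every `p` and `q`

A pair `(s_k, d_k)` of a mixed system is *tight* when `d_k = 2 s_k`; then the letters `0, s, d, s+d, 2s, 2d` take
the values `0, s, 2s, 3s, 2s, 4s` and the long pattern `(2,-1)` is a *free* allowed relation of value `0`.  The
`4^N - 1` extremal designs known (the base-4 design `s_k = 4^(k-1)` and, at `N = 3`, all pairings of
`{1,2,4,8,16,32}`) contain tight pairs, and mixing tight and loose pairs is where the general conjecture
(`HallSixConjecture`) is open.  This file settles the all-tight case completely: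

**Theorem (tight closure).**  If every pair of a mixed design (`IsMixedDesign`, the Gordan/vertex form of door D7)
is tight, then the `4^p · 2^q` sums `∑ a_k s_k + ∑_{i ∈ B} t_i` (`a_k ∈ {0,1,2,3}`, `B ⊆` singletons) are pairwise
distinct (`tight_wordVal_injective`); hence `4^p · 2^q ≤ σ + 1` (`tight_mixedClosure`), i.e. MIXED CLOSURE holds
with equality exactly for the perfect (base-4-like) systems.

Proof.  A coincidence gives an integer relation `∑ n_k s_k + ∑ m_i t_i = 0` with `|n_k| ≤ 3`, `|m_i| ≤ 1`, not all
zero.  Realise `n_k` by the allowed pattern `P(n_k)` (`3 ↦ (-1,2)`, `-3 ↦ (-1,-1)`, `2 ↦ (0,1)`, `1 ↦ (1,0)`,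
`-1 ↦ (-1,0)`, `-2 ↦ (0,-1)`; value `(a + 2b) s_k = n_k s_k`), `-n_k` by `P(-n_k)`, and add the free relation
`F(n_k) = (2,-1)` exactly where `|n_k| = 3`: the three allowed value-`0` relations `(P∘n, m)`, `(P∘(-n), -m)`,
`(F∘n, 0)` have zero column sums, so the design weights `y` give `⟪y,r¹⟫ ≥ 1`, `⟪y,r²⟫ ≥ 1`, `⟪y,r³⟫ ≥ 0` and
`⟪y,r¹⟫ + ⟪y,r²⟫ + ⟪y,r³⟫ = 0` — a contradiction (a balanced family of length 2 or 3, cf. Theorem A).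

Written by the solo-informed seat (gen 13, CLAIMS c143); standard axioms only.
-/

namespace Summit.MatrixMultiplication.MatrixMultiplication.Theorems

open Finset

/-- The allowed pattern realising the coefficient `n ∈ [-3,3]` on a tight pair: value `(P₁ n + 2 P₂ n) s = n s`. -/
def tightP (n : ℤ) : ℤ × ℤ :=
  if n = 3 then (-1, 2) else if n = -3 then (-1, -1) else if n = 2 then (0, 1) else if n = -2 then (0, -1)
  else (n, 0)

/-- The free relation `(2,-1)` (value `0` on a tight pair), inserted where `|n| = 3`. -/
def tightF (n : ℤ) : ℤ × ℤ := if n = 3 ∨ n = -3 then (2, -1) else (0, 0)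

/-- `P(n)` has value `n` on a tight pair (coefficient of `s`: first + 2·second). -/
theorem tightP_value (n : ℤ) : (tightP n).1 + 2 * (tightP n).2 = n := by
  unfold tightP; split_ifs <;> simp_all

/-- `P(n)` is an allowed pattern for `n ∈ [-3,3]`. -/
theorem tightP_allowed (n : ℤ) (hn : -3 ≤ n) (hn' : n ≤ 3) :
    -1 ≤ (tightP n).1 ∧ -1 ≤ (tightP n).2 ∧ (tightP n).1 + (tightP n).2 ≤ 1 := by
  interval_cases n <;> simp [tightP]

/-- `P(n) ≠ 0` for `n ≠ 0`. -/
theorem tightP_ne_zero (n : ℤ) (h0 : n ≠ 0) : tightP n ≠ (0, 0) := by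
  unfold tightP; split_ifs <;> simp_all

/-- The free relation has value `0` on a tight pair. -/
theorem tightF_value (n : ℤ) : (tightF n).1 + 2 * (tightF n).2 = 0 := by
  unfold tightF; split_ifs <;> simp

/-- The free relation is an allowed pattern. -/
theorem tightF_allowed (n : ℤ) : -1 ≤ (tightF n).1 ∧ -1 ≤ (tightF n).2 ∧ (tightF n).1 + (tightF n).2 ≤ 1 := by
  unfold tightF; split_ifs <;> simp

/-- Zero column sums: `P(n) + P(-n) + F(n) = 0` componentwise, for `n ∈ [-3,3]`. -/
theorem tight_column (n : ℤ) (hn : -3 ≤ n) (hn' : n ≤ 3) :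
    (tightP n).1 + (tightP (-n)).1 + (tightF n).1 = 0 ∧ (tightP n).2 + (tightP (-n)).2 + (tightF n).2 = 0 := by
  interval_cases n <;> simp [tightP, tightF]

/-- The value of the word `(a, B)` of an all-tight system: `∑ a_k s_k + ∑_{i∈B} t_i` (`a_k ∈ {0,…,3}` codes the
letters `0, s, d = 2s, s+d = 3s`). -/
def tightWordVal {p q : ℕ} (s : Fin p → ℕ) (t : Fin q → ℕ) (m : HWord p q) : ℕ :=
  (∑ k, (m.1 k : ℕ) * s k) + ∑ i, (if i ∈ m.2 then t i else 0)

/-- Word values of an all-tight system lie in `[0, σ]`. -/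
theorem tightWordVal_le {p q : ℕ} (s d : Fin p → ℕ) (t : Fin q → ℕ) (htight : ∀ k, d k = 2 * s k)
    (m : HWord p q) : tightWordVal s t m ≤ mixedSigma s d t := by
  unfold tightWordVal mixedSigma
  have h1 : (∑ k, (m.1 k : ℕ) * s k) ≤ ∑ k, (s k + d k) := by
    apply Finset.sum_le_sum; intro k _
    have : (m.1 k : ℕ) ≤ 3 := by omega
    rw [htight k]; nlinarith
  have h2 : (∑ i, (if i ∈ m.2 then t i else 0)) ≤ ∑ i, t i := by
    apply Finset.sum_le_sum; intro i _; split_ifs <;> omega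
  omega

/-- **3-dissociation of an all-tight mixed design**: the word values are pairwise distinct. -/
theorem tight_wordVal_injective {p q : ℕ} (s d : Fin p → ℕ) (t : Fin q → ℕ) (htight : ∀ k, d k = 2 * s k)
    (hD : IsMixedDesign s d t) : Function.Injective (tightWordVal (q := q) s t) := by
  classical
  obtain ⟨_, ys, yd, yt, hy⟩ := hD
  intro m m' hmm
  by_contra hne
  -- the integer relation
  set n : Fin p → ℤ := fun k => (m.1 k : ℤ) - (m'.1 k : ℤ) with hn
  set μ : Fin q → ℤ := fun i => (if i ∈ m.2 then (1:ℤ) else 0) - (if i ∈ m'.2 then (1:ℤ) else 0) with hμ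
  have hnb : ∀ k, -3 ≤ n k ∧ n k ≤ 3 := by
    intro k; simp only [hn]; have h1 : (m.1 k : ℕ) ≤ 3 := by omega
    have h2 : (m'.1 k : ℕ) ≤ 3 := by omega
    constructor <;> omega
  have hμb : ∀ i, -1 ≤ μ i ∧ μ i ≤ 1 := by
    intro i; simp only [hμ]; split_ifs <;> simp
  have hrel : (∑ k, n k * (s k : ℤ)) + ∑ i, μ i * (t i : ℤ) = 0 := by
    have hc : ((tightWordVal s t m : ℕ) : ℤ) = ((tightWordVal s t m' : ℕ) : ℤ) := by exact_mod_cast hmm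
    unfold tightWordVal at hc
    push_cast at hc
    have e1 : (∑ k, n k * (s k : ℤ)) = (∑ k, ((m.1 k : ℕ) : ℤ) * (s k : ℤ)) - ∑ k, ((m'.1 k : ℕ) : ℤ) * (s k : ℤ) := by
      rw [← Finset.sum_sub_distrib]; apply Finset.sum_congr rfl; intro k _; simp only [hn]; ring
    have e2 : (∑ i, μ i * (t i : ℤ)) = (∑ i, (if i ∈ m.2 then (t i : ℤ) else 0)) - ∑ i, (if i ∈ m'.2 then (t i : ℤ) else 0) := by
      rw [← Finset.sum_sub_distrib]; apply Finset.sum_congr rfl; intro i _; simp only [hμ]; split_ifs <;> simp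
    rw [e1, e2]; linarith
  -- nontriviality: some n k ≠ 0 or some μ i ≠ 0
  have hnz : (∃ k, n k ≠ 0) ∨ (∃ i, μ i ≠ 0) := by
    by_contra hall
    push Not at hall
    apply hne
    obtain ⟨h1, h2⟩ := hall
    have em1 : m.1 = m'.1 := by
      funext k; have := h1 k; simp only [hn] at this; apply Fin.ext; omega
    have em2 : m.2 = m'.2 := by
      ext i; have := h2 i; simp only [hμ] at this
      constructor <;> intro hi <;> by_contra hi' <;> simp [hi, hi'] at this
    exact Prod.ext em1 em2
  -- the three relations
  let a1 : Fin p → ℤ := fun k => (tightP (n k)).1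
  let b1 : Fin p → ℤ := fun k => (tightP (n k)).2
  let a2 : Fin p → ℤ := fun k => (tightP (-n k)).1
  let b2 : Fin p → ℤ := fun k => (tightP (-n k)).2
  let a3 : Fin p → ℤ := fun k => (tightF (n k)).1
  let b3 : Fin p → ℤ := fun k => (tightF (n k)).2
  let c1 : Fin q → ℤ := μ
  let c2 : Fin q → ℤ := fun i => -μ i
  let c3 : Fin q → ℤ := fun _ => 0
  have hd : ∀ k, (d k : ℤ) = 2 * (s k : ℤ) := by intro k; exact_mod_cast htight k
  -- values
  have v1 : (∑ k, (a1 k * (s k : ℤ) + b1 k * (d k : ℤ))) + ∑ i, c1 i * (t i : ℤ) = 0 := by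
    have : (∑ k, (a1 k * (s k : ℤ) + b1 k * (d k : ℤ))) = ∑ k, n k * (s k : ℤ) := by
      apply Finset.sum_congr rfl; intro k _
      have := tightP_value (n k)
      simp only [a1, b1, hd k]; linear_combination (s k : ℤ) * this
    rw [this]; simpa [c1] using hrel
  have v2 : (∑ k, (a2 k * (s k : ℤ) + b2 k * (d k : ℤ))) + ∑ i, c2 i * (t i : ℤ) = 0 := by
    have e : (∑ k, (a2 k * (s k : ℤ) + b2 k * (d k : ℤ))) = ∑ k, (-n k) * (s k : ℤ) := by
      apply Finset.sum_congr rfl; intro k _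
      have := tightP_value (-n k)
      simp only [a2, b2, hd k]; linear_combination (s k : ℤ) * this
    have e' : (∑ i, c2 i * (t i : ℤ)) = -∑ i, μ i * (t i : ℤ) := by
      rw [← Finset.sum_neg_distrib]; apply Finset.sum_congr rfl; intro i _; simp [c2]
    rw [e, e']
    have : (∑ k, (-n k) * (s k : ℤ)) = -∑ k, n k * (s k : ℤ) := by
      rw [← Finset.sum_neg_distrib]; apply Finset.sum_congr rfl; intro k _; ring
    rw [this]; linarith
  have v3 : (∑ k, (a3 k * (s k : ℤ) + b3 k * (d k : ℤ))) + ∑ i, c3 i * (t i : ℤ) = 0 := by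
    have e : (∑ k, (a3 k * (s k : ℤ) + b3 k * (d k : ℤ))) = 0 := by
      apply Finset.sum_eq_zero; intro k _
      have := tightF_value (n k)
      simp only [a3, b3, hd k]; linear_combination (s k : ℤ) * this
    simp [e, c3]
  -- allowedness
  have al1 : IsAllowedRelation a1 b1 c1 :=
    ⟨fun k => tightP_allowed (n k) (hnb k).1 (hnb k).2, fun i => hμb i⟩
  have al2 : IsAllowedRelation a2 b2 c2 :=
    ⟨fun k => tightP_allowed (-n k) (by linarith [(hnb k).2]) (by linarith [(hnb k).1]),
     fun i => by constructor <;> simp only [c2] <;> linarith [(hμb i).1, (hμb i).2]⟩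
  have al3 : IsAllowedRelation a3 b3 c3 :=
    ⟨fun k => tightF_allowed (n k), fun i => by simp [c3]⟩
  -- nonzero-ness of r¹ and r²
  have nz1 : a1 ≠ 0 ∨ b1 ≠ 0 ∨ c1 ≠ 0 := by
    rcases hnz with ⟨k, hk⟩ | ⟨i, hi⟩
    · have hP := tightP_ne_zero (n k) hk
      by_cases ha : (tightP (n k)).1 = 0
      · right; left; intro hb; apply hP
        have hb' : (tightP (n k)).2 = 0 := by simpa [b1] using congrFun hb k
        exact Prod.ext ha hb'
      · left; intro hz; exact ha (by simpa [a1] using congrFun hz k)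
    · right; right; intro hz; exact hi (by simpa [c1] using congrFun hz i)
  have nz2 : a2 ≠ 0 ∨ b2 ≠ 0 ∨ c2 ≠ 0 := by
    rcases hnz with ⟨k, hk⟩ | ⟨i, hi⟩
    · have hP := tightP_ne_zero (-n k) (by omega)
      by_cases ha : (tightP (-n k)).1 = 0
      · right; left; intro hb; apply hP
        have hb' : (tightP (-n k)).2 = 0 := by simpa [b2] using congrFun hb k
        exact Prod.ext ha hb'
      · left; intro hz; exact ha (by simpa [a2] using congrFun hz k)
    · right; right; intro hz; apply hi; have := congrFun hz i; simp [c2] at this; linarith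
  have i1 := hy a1 b1 c1 al1 v1 nz1
  have i2 := hy a2 b2 c2 al2 v2 nz2
  -- r³: either zero (weight 0) or a nonzero allowed value-0 relation (weight ≥ 1); in both cases weight ≥ 0
  have i3 : 0 ≤ (∑ k, (a3 k * ys k + b3 k * yd k)) + ∑ i, c3 i * yt i := by
    by_cases hz : a3 ≠ 0 ∨ b3 ≠ 0 ∨ c3 ≠ 0
    · have := hy a3 b3 c3 al3 v3 hz; linarith
    · push Not at hz; obtain ⟨ha, hb, _⟩ := hz
      have : (∑ k, (a3 k * ys k + b3 k * yd k)) = 0 := by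
        apply Finset.sum_eq_zero; intro k _; simp [congrFun ha k, congrFun hb k]
      simp [this, c3]
  -- zero column sums
  have tot : ((∑ k, (a1 k * ys k + b1 k * yd k)) + ∑ i, c1 i * yt i)
      + ((∑ k, (a2 k * ys k + b2 k * yd k)) + ∑ i, c2 i * yt i)
      + ((∑ k, (a3 k * ys k + b3 k * yd k)) + ∑ i, c3 i * yt i) = 0 := by
    have hk : ∀ k, (a1 k * ys k + b1 k * yd k) + (a2 k * ys k + b2 k * yd k) + (a3 k * ys k + b3 k * yd k) = 0 := by
      intro k
      obtain ⟨h1, h2⟩ := tight_column (n k) (hnb k).1 (hnb k).2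
      simp only [a1, b1, a2, b2, a3, b3]
      linear_combination ys k * h1 + yd k * h2
    have hi : ∀ i, c1 i * yt i + c2 i * yt i + c3 i * yt i = 0 := by intro i; simp [c1, c2, c3]
    have e1 : (∑ k, (a1 k * ys k + b1 k * yd k)) + (∑ k, (a2 k * ys k + b2 k * yd k))
        + (∑ k, (a3 k * ys k + b3 k * yd k)) = 0 := by
      rw [← Finset.sum_add_distrib, ← Finset.sum_add_distrib]; exact Finset.sum_eq_zero (fun k _ => hk k)
    have e2 : (∑ i, c1 i * yt i) + (∑ i, c2 i * yt i) + (∑ i, c3 i * yt i) = 0 := by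
      rw [← Finset.sum_add_distrib, ← Finset.sum_add_distrib]; exact Finset.sum_eq_zero (fun i _ => hi i)
    linarith
  linarith

/-- **Tight closure.**  An all-tight mixed design with `p` pairs and `q` singletons has `4^p · 2^q ≤ σ + 1`. -/
theorem tight_mixedClosure {p q : ℕ} (s d : Fin p → ℕ) (t : Fin q → ℕ) (htight : ∀ k, d k = 2 * s k)
    (hD : IsMixedDesign s d t) : 4 ^ p * 2 ^ q ≤ mixedSigma s d t + 1 := by
  classical
  let f : HWord p q → Fin (mixedSigma s d t + 1) :=
    fun m => ⟨tightWordVal s t m, Nat.lt_succ_of_le (tightWordVal_le s d t htight m)⟩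
  have hf : Function.Injective f := by
    intro a b hab
    exact tight_wordVal_injective s d t htight hD (by simpa [f] using congrArg Fin.val hab)
  have hcard := Fintype.card_le_of_injective f hf
  simpa [HWord, Fintype.card_prod, Fintype.card_fun, Fintype.card_finset, Fintype.card_fin] using hcard

/-- In particular an all-tight mixed design satisfies `HallSix` trivially?  No — but it satisfies the CONCLUSION
of `hallSix_closure`; together with `onePair_mixed_closure` (p ≤ 1) these are the two proved cases of MIXED
CLOSURE. -/
theorem tight_designClosure {p : ℕ} (s d : Fin p → ℕ) (htight : ∀ k, d k = 2 * s k)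
    (hD : IsMixedDesign s d (Fin.elim0 : Fin 0 → ℕ)) : 4 ^ p ≤ mixedSigma s d (Fin.elim0 : Fin 0 → ℕ) + 1 := by
  simpa using tight_mixedClosure s d Fin.elim0 htight hD

end Summit.MatrixMultiplication.MatrixMultiplication.Theorems
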